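import Mathlib
import HarnessLib
import HarnessLib.Audit

/-!
# Lax conjecture / Helton–Vinnikov: ternary hyperbolic forms are symmetric determinantal

A NAMED FACT (D-0014, statement only), requested by route MatrixMultiplication/HyperbolicRankMethods
(support item `GardingRankSubadditive`, stmt-MatrixMultiplication-10092). It grounds
`Summit.MatrixMultiplication.MatrixMultiplication.Theses.HyperbolicRankMethods.GardingRankSubadditive`
as a COROLLARY, not as an instance: restrict a hyperbolic `h ∈ ℝ[x₁, …, x_N]` to the `3`-plane
`span(e, u, v)`, normalise by `h(e)`, and read the Gårding ranks `d − ord_{t=0} h(w + te)` of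
`u`, `v`, `u + v` as the ranks of the real symmetric matrices `B`, `C`, `B + C` below
(`rk (B + C) ≤ rk B + rk C`); the degenerate case `dim span(e,u,v) ≤ 2` factors into linear forms.

* `LewisParriloRamana2005_laxConjecture` — A. S. Lewis, P. A. Parrilo, M. V. Ramana, *The Lax
  conjecture is true*, Proc. Amer. Math. Soc. 133 (2005) 2495–2499 (= arXiv:math/0304104, held
  text). **Conjecture 2 (Lax, 1958)**, proved there (main result) by the reduction **Proposition 3**
  to **Theorem 4** (= J. W. Helton, V. Vinnikov, *Linear matrix inequality representation of sets*,
  Comm. Pure Appl. Math. 60 (2007) 654–674, arXiv:math/0306180, **Thm. 2.2**, converse part for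
  `m = 2`: a real-zero polynomial `q` of degree `d` on `ℝ²` with `q(0,0) = 1` is
  `q(y,z) = det(I + yB + zC)` with `B, C ∈ S^d`):
  "A polynomial `p` on `ℝ³` is hyperbolic of degree `d` with respect to the vector `e = (1,0,0)`
  and satisfies `p(e) = 1` if and only if there exist matrices `B, C ∈ S^d` such that `p` is given
  by `p(x,y,z) = det(xI + yB + zC)`."
  Printed definitions (ibid., §1): `H³(d)` = homogeneous polynomials of degree `d` on `ℝ³`;
  `p ∈ H³(d)` is *hyperbolic with respect to* `e` if `p(e) ≠ 0` and, for all `w ∈ ℝ³`, the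
  univariate polynomial `t ↦ p(w − te)` has all real roots; `S^d` = real symmetric `d × d`
  matrices.

## Rendering
* `p : MvPolynomial (Fin 3) ℝ` with `p.IsHomogeneous d`; `e = ![1, 0, 0]`;
  `MvPolynomial.eval ![1, 0, 0] p = 1`.
* "`t ↦ p(w − te)` has all real roots": the univariate polynomial is
  `MvPolynomial.aeval (fun i => Polynomial.C (w i) - Polynomial.C (e i) * Polynomial.X) p ∈ ℝ[t]`.
  As `p` is homogeneous of degree `d` with `p(e) = 1`, its `t^d`-coefficient is `(-1)^d ≠ 0`, so it
  is a non-zero polynomial of degree exactly `d`, and "all roots real" is rendered as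
  `Multiset.card (…).roots = d` (roots in `ℝ`, with multiplicity) — the rendering of hyperbolicity
  used by the requesting route (which writes `w + te`; substitute `t ↦ −t`).
* Only the non-trivial implication (hyperbolic ⇒ symmetric determinantal) is vendored; the
  converse is "immediate" (ibid.) and is not what users need as a hypothesis.
* `p(x,y,z) = det(xI + yB + zC)` for all real `x, y, z`, as functions (equivalently as
  polynomials, `ℝ` being infinite): `MvPolynomial.eval ![x, y, z] p = (x • 1 + y • B + z • C).det`.

## References
* [LewisParriloRamana2005] A. S. Lewis, P. A. Parrilo, M. V. Ramana, The Lax conjecture is true,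
  Proc. AMS 133 (2005) 2495–2499; arXiv:math/0304104: Conjecture 2, Proposition 3, Theorem 4.
* [HeltonVinnikov2006] J. W. Helton, V. Vinnikov, Linear matrix inequality representation of
  sets, CPAM 60 (2007) 654–674; arXiv:math/0306180: §2.1 (RZ polynomials), Thm. 2.2.
* P. D. Lax, Differential equations, difference equations and matrix theory, CPAM 11 (1958)
  175–194 (the conjecture).
-/

noncomputable section

open MvPolynomial Matrix

namespace Literature.AlgebraicGeometry.DeterminantalHypersurfaces

/-- **Lax conjecture (1958) = theorem of Lewis–Parrilo–Ramana 2005 via Helton–Vinnikov**, the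
non-trivial implication: if `p ∈ ℝ[x,y,z]` is homogeneous of degree `d`, `p(1,0,0) = 1`, and for
every `w ∈ ℝ³` the univariate polynomial `t ↦ p(w − t·(1,0,0))` has all its `d` roots real
(hyperbolicity with respect to `e = (1,0,0)`), then there are real symmetric `d × d` matrices
`B, C` with `p(x,y,z) = det(xI + yB + zC)` for all real `x, y, z`. Grounds (as a corollary, see
the module docstring) `Summit.MatrixMultiplication.MatrixMultiplication.Theses.HyperbolicRankMethods.GardingRankSubadditive`.
[cite: LewisParriloRamana2005, Conjecture 2 (Lax) with Proposition 3 and Theorem 4]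
[cite: HeltonVinnikov2006, Thm. 2.2] -/
@[conjecture] def LewisParriloRamana2005_laxConjecture : Prop :=
  ∀ (d : ℕ) (p : MvPolynomial (Fin 3) ℝ), p.IsHomogeneous d →
    MvPolynomial.eval ![1, 0, 0] p = 1 →
    (∀ w : Fin 3 → ℝ, Multiset.card (MvPolynomial.aeval
        (fun i => Polynomial.C (w i) - Polynomial.C ((![1, 0, 0] : Fin 3 → ℝ) i) * Polynomial.X)
        p).roots = d) →
    ∃ B C : Matrix (Fin d) (Fin d) ℝ, B.IsSymm ∧ C.IsSymm ∧
      ∀ x y z : ℝ, MvPolynomial.eval ![x, y, z] p =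
        (x • (1 : Matrix (Fin d) (Fin d) ℝ) + y • B + z • C).det

end Literature.AlgebraicGeometry.DeterminantalHypersurfaces
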